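import Summits.QuantumFields.BalabanUV.Beta.D1BFx.MixedVarPackedHess

/-!
# `BalabanUV.Beta.D1BFx.ShearedBorderKKT` — road «BF-x» for binder row D1, slot (K), brick «TB1-SYM» PART (ii): **THE GENERIC BORDER-SHEAR CONGRUENCE OF THE
# COMB-GAUGED BORDERED MATRIX AND THE TWO-SIDED TRANSPORT OF THE TORUS ONE-LOOP FUNCTIONAL** — for a fine-block shear `U` and a border scaling `c`,
# `Tᵀ · kkt K [Q; τ] · T = kkt (UᵀKU) [c•QU; τU]` with `T = diag(U, c, 1)` (EVERY row displayed, the slice rows `τ` included); on the road's case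
# `UᵀKU = K`, `τU = τ` this is `kkt K [c•QU; τ] = Tᵀ · kkt K [Q; τ] · T`, hence the packed corner of the inverse is `A · (kkt K [Q; τ])⁻¹|_{ν⊕μ} · Aᵀ`,
# `A = diag(U⁻¹, c⁻¹)`, and `hessT` moves `A` from the leg to the jets: `hessT (A L Aᵀ) V V′ W = hessT L (AᵀVA) (AᵀV′A) (AᵀWA)`
# (β sub-cell, BINDER-OWNERS row D1; road «BF-x» OWNER d1-p2-g7's rulings ρ-g7-2 (b), ρ-g7-4 (ii) and ADDENDUM (journal 2026-08-21 l.25033);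
# cross-lane idle seat `b2b-balaban-t4-ne9-formalise-leaf-09` gen 39 under the «K-U3d authors» first refusal)

HONEST FRAMING (cell charter, verbatim): «discharging BetaPertH makes Balaban's UV stability UNCONDITIONAL — a real
constructive-QFT result; it is NOT the continuum limit and NOT the Clay problem.»
HONEST DEPENDENCY: continuum YM on T⁴ ⇐ BetaPertH ∧ nine spine estimates (0/9 proved); BetaPertH ⇐ (D1) ∧ (D4) ∧ CAP+tail;
G-an2-4 gates asym, D1 and NE2/3/4.
ABSOLUTE RULE (cell, verbatim): «No internally-minted statement may enter as a cited fact. Every hypothesis is either kernel-proved in this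
package or a verbatim quotation of a PUBLISHED theorem with page reference. The manuscript(s) under audit are NOT citable for their own
disputed steps — they are the thing under adjudication; programme-internal (2001/route/tribunal) claims are never citable.»
NOTHING below is cited: no `[cite: …]`, no `def`, no `Prop` fact.  Every declaration is [folklore] finite-dimensional matrix algebra over `ℝ` (Mathlib block
matrices; the cell's `Composition.kkt` and `D1BFx.MixedVarPackedHess.hessT` BY NAME).  `K`, `Q`, `τ`, `U`, `c`, the legs and the jets are PARAMETERS: nothing
about Bałaban's operators is asserted.  0 wall binders; NOT the (K) slot, NOT D1, NOT `BetaPertH`, NOT continuum, NOT Clay.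

WHY (road owner d1-p2-g7).  The row-D1 literal was RE-BASED on B12's symmetrised averaging (an2-g25 R-D1-g25-1); on the road's comb slice the
symmetrised border is a SHEARED and SCALED straight border, `Q̂_sym = D!•Q̂·Û` with a unipotent fine shear `Û` that fixes `K̂` and the comb rows `τ`
(ADDENDUM: `K̂(Û−1) = 0`, `τ(Û−1) = 0`).  THIS FILE is the owner-independent algebra: the bordered matrix of the sheared data is an exact CONGRUENCE of the
old one, so TB1's `inv_MT_packed_eq` and TB5's limits apply VERBATIM to SHEARED JETS.  PART (i) (the three letters on the torus from an2's S1∕K1) and PART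
(iii) (the instance) are NOT here.

WHAT (`e := Sum.map id Sum.inl : ν ⊕ μ → ν ⊕ (μ ⊕ ρ)` the packed corner; `T := fromBlocks U 0 0 (fromBlocks (c • 1) 0 0 1)`, `A := fromBlocks U⁻¹ 0 0 (c⁻¹ • 1)`, written out):
§1 `kkt_eq_fromBlocks`, **`kkt_shear`** (general form: `Tᵀ · kkt K [Q;τ] · T = kkt (UᵀKU) [c•QU; τU]`), `transpose_mul_mul_eq_of_mul_sub_one` (`K(U−1) = 0`, `Kᵀ = K` ⟹ `UᵀKU = K`),
   `mul_eq_of_mul_sub_one` (`τ(U−1) = 0` ⟹ `τU = τ`), **`kkt_shear_slice`** (`UᵀKU = K`, `τU = τ` ⟹ `kkt K [c•QU; τ] = Tᵀ · kkt K [Q;τ] · T`).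
§2 `shearT_mul_inv`∕`inv_mul_shearT` (`T · T′ = 1 = T′ · T`, `T′ := fromBlocks U⁻¹ 0 0 (fromBlocks (c⁻¹ • 1) 0 0 1)`), **`inv_kkt_shear_slice`**
   (`(kkt K [c•QU; τ])⁻¹ = T′ · (kkt K [Q;τ])⁻¹ · T′ᵀ`), `submatrix_blockDiag_mul_mul` (block-diagonal factors commute with the `e`-restriction),
   **`inv_kkt_shear_submatrix`** (`(kkt K [c•QU; τ])⁻¹|_{ν⊕μ} = A · (kkt K [Q;τ])⁻¹|_{ν⊕μ} · Aᵀ`).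
§3 **`hessT_conj`** (`hessT (A L Aᵀ) V V′ W = hessT L (AᵀVA) (AᵀV′A) (AᵀWA)`, trace cyclicity, any square `A`), **`hessT_inv_kkt_shear`** (the model END:
   `hessT ((kkt K [c•QU; τ])⁻¹|_{ν⊕μ}) V V′ W = hessT ((kkt K [Q;τ])⁻¹|_{ν⊕μ}) (AᵀVA) (AᵀV′A) (AᵀWA)`).
§4 («3c-SYM», appended) `kkt_shear_packed`, **`kkt_shear_packed_weight`** (`kkt (K + UᵀBU) (c•QU) = Sᵀ · kkt (K + B) Q · S`, `S = fromBlocks U 0 0 (c•1)`),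
   `packS_mul_inv`∕`inv_mul_packS`, **`inv_kkt_shear_packed`** (`= A · (kkt (K + B) Q)⁻¹ · Aᵀ`, the SAME `A`), **`hessT_inv_kkt_shear_packed`**, **`hessT_sub_shear`**
   (TB5's M − N difference transports as a whole to the sheared jets).
Provenance: β sub-cell; cross-lane idle seat `b2b-balaban-t4-ne9-formalise-leaf-09` gen 39 (prover-b2b-balaban-t4-ne9-formalise-leaf-09-g39-0), 2026-08-21 (INTENT journal
l.25678).  NOT (SDF), NOT D1, NOT `BetaPertH`, NOT continuum, NOT Clay.
-/

noncomputable section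

namespace Summit.QuantumFields.BalabanUV.Beta.D1BFx.ShearedBorderKKT

open Matrix
open Literature.MathematicalPhysics.QuantumFieldTheory.Balaban1983to89.Beta.Composition (kkt)
open Summit.QuantumFields.BalabanUV.Beta.D1BFx.MixedVarPackedHess (hessT)

variable {ν μ ρ : Type*} [Fintype ν] [Fintype μ] [Fintype ρ] [DecidableEq ν] [DecidableEq μ] [DecidableEq ρ]

/-! ## §1 The congruence -/

omit [Fintype ν] [Fintype μ] [Fintype ρ] [DecidableEq ν] [DecidableEq μ] [DecidableEq ρ] in
/-- [folklore] `kkt K [Q; τ]` as a `2 × 2` block matrix with the border `R = fromRows Q τ`. -/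
theorem kkt_eq_fromBlocks (K : Matrix ν ν ℝ) (Q : Matrix μ ν ℝ) (τ : Matrix ρ ν ℝ) :
    kkt K (fromRows Q τ) = fromBlocks K (fromRows Q τ)ᵀ (fromRows Q τ) 0 := rfl

omit [Fintype ν] [Fintype μ] [Fintype ρ] [DecidableEq ν] in
/-- [folklore] The border-scaling block `diag(c, 1)` is symmetric. -/
theorem transpose_scaleBlock (c : ℝ) :
    (fromBlocks (c • (1 : Matrix μ μ ℝ)) 0 0 (1 : Matrix ρ ρ ℝ))ᵀ = fromBlocks (c • (1 : Matrix μ μ ℝ)) 0 0 (1 : Matrix ρ ρ ℝ) := by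
  rw [fromBlocks_transpose, transpose_smul, transpose_one, transpose_one, transpose_zero, transpose_zero]

omit [DecidableEq ν] in
/-- [folklore] The scaling block acts on the border rows: `diag(c, 1) · [Q; τ] · U = [c•QU; τU]`. -/
theorem scaleBlock_mul_fromRows_mul (Q : Matrix μ ν ℝ) (τ : Matrix ρ ν ℝ) (U : Matrix ν ν ℝ) (c : ℝ) :
    fromBlocks (c • (1 : Matrix μ μ ℝ)) 0 0 (1 : Matrix ρ ρ ℝ) * fromRows Q τ * U = fromRows (c • (Q * U)) (τ * U) := by
  rw [fromBlocks_mul_fromRows, Matrix.zero_mul, Matrix.zero_mul, add_zero, zero_add, Matrix.one_mul, Matrix.smul_mul, Matrix.one_mul,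
    fromRows_mul, Matrix.smul_mul]

omit [DecidableEq ν] in
/-- [folklore] **THE BORDER-SHEAR CONGRUENCE, GENERAL FORM** — with `T = fromBlocks U 0 0 (fromBlocks (c•1) 0 0 1)` (fine shear `U`, border scaling `c`,
comb rows untouched): `Tᵀ · kkt K [Q; τ] · T = kkt (UᵀKU) [c•QU; τU]`.  EVERY row of the result is displayed; in particular the slice rows become `τU`. -/
theorem kkt_shear (K : Matrix ν ν ℝ) (Q : Matrix μ ν ℝ) (τ : Matrix ρ ν ℝ) (U : Matrix ν ν ℝ) (c : ℝ) :
    (fromBlocks U 0 0 (fromBlocks (c • (1 : Matrix μ μ ℝ)) 0 0 (1 : Matrix ρ ρ ℝ)))ᵀ * kkt K (fromRows Q τ)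
        * fromBlocks U 0 0 (fromBlocks (c • (1 : Matrix μ μ ℝ)) 0 0 (1 : Matrix ρ ρ ℝ))
      = kkt (Uᵀ * K * U) (fromRows (c • (Q * U)) (τ * U)) := by
  have hR := scaleBlock_mul_fromRows_mul Q τ U c
  have hRt : Uᵀ * (fromRows Q τ)ᵀ * fromBlocks (c • (1 : Matrix μ μ ℝ)) 0 0 (1 : Matrix ρ ρ ℝ) = (fromRows (c • (Q * U)) (τ * U))ᵀ := by
    rw [← hR, transpose_mul, transpose_mul, transpose_scaleBlock, Matrix.mul_assoc]
  rw [kkt_eq_fromBlocks, kkt_eq_fromBlocks, fromBlocks_transpose, transpose_scaleBlock, fromBlocks_multiply, fromBlocks_multiply]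
  simp only [transpose_zero, Matrix.zero_mul, Matrix.mul_zero, add_zero, zero_add]
  rw [hRt, Matrix.mul_assoc (fromBlocks (c • (1 : Matrix μ μ ℝ)) 0 0 1) (fromRows Q τ) U, ← Matrix.mul_assoc, hR]

omit [Fintype μ] [Fintype ρ] [DecidableEq μ] [DecidableEq ρ] in
/-- [folklore] `K(U − 1) = 0` and `Kᵀ = K` give `UᵀKU = K` (the road's letter `K̂(Û−1) = 0`, `K̂` symmetric). -/
theorem transpose_mul_mul_eq_of_mul_sub_one {K U : Matrix ν ν ℝ} (hKU : K * (U - 1) = 0) (hK : Kᵀ = K) : Uᵀ * K * U = K := by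
  have h1 : K * U = K := by
    have := hKU; rw [Matrix.mul_sub, Matrix.mul_one, sub_eq_zero] at this; exact this
  have h2 : Uᵀ * K = K := by
    have := congrArg transpose h1
    rw [transpose_mul, hK] at this
    exact this
  rw [h2, h1]

omit [Fintype μ] [Fintype ρ] [DecidableEq μ] [DecidableEq ρ] in
/-- [folklore] `τ(U − 1) = 0` gives `τU = τ` (the road's letter: comb bonds are intra-block, the shear is the differential of a block-constant gauge function). -/
theorem mul_eq_of_mul_sub_one {τ : Matrix ρ ν ℝ} {U : Matrix ν ν ℝ} (hτU : τ * (U - 1) = 0) : τ * U = τ := by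
  rw [Matrix.mul_sub, Matrix.mul_one, sub_eq_zero] at hτU; exact hτU

omit [DecidableEq ν] in
/-- [folklore] **THE BORDER-SHEAR CONGRUENCE ON THE SLICE** — when the shear fixes `K` by congruence and fixes the comb rows (`UᵀKU = K`, `τU = τ`):
`kkt K [c•QU; τ] = Tᵀ · kkt K [Q; τ] · T`. -/
theorem kkt_shear_slice {K U : Matrix ν ν ℝ} {τ : Matrix ρ ν ℝ} (hK : Uᵀ * K * U = K) (hτ : τ * U = τ) (Q : Matrix μ ν ℝ) (c : ℝ) :
    kkt K (fromRows (c • (Q * U)) τ)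
      = (fromBlocks U 0 0 (fromBlocks (c • (1 : Matrix μ μ ℝ)) 0 0 (1 : Matrix ρ ρ ℝ)))ᵀ * kkt K (fromRows Q τ)
          * fromBlocks U 0 0 (fromBlocks (c • (1 : Matrix μ μ ℝ)) 0 0 (1 : Matrix ρ ρ ℝ)) := by
  rw [kkt_shear, hK, hτ]

/-! ## §2 The inverse and its packed corner -/

/-- [folklore] The inverse shear `T′ = fromBlocks U⁻¹ 0 0 (fromBlocks (c⁻¹•1) 0 0 1)` is a right inverse of `T` (`IsUnit U.det`, `c ≠ 0`). -/
theorem shearT_mul_inv {U : Matrix ν ν ℝ} (hU : IsUnit U.det) {c : ℝ} (hc : c ≠ 0) :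
    fromBlocks U 0 0 (fromBlocks (c • (1 : Matrix μ μ ℝ)) 0 0 (1 : Matrix ρ ρ ℝ))
        * fromBlocks U⁻¹ 0 0 (fromBlocks (c⁻¹ • (1 : Matrix μ μ ℝ)) 0 0 (1 : Matrix ρ ρ ℝ)) = 1 := by
  rw [fromBlocks_multiply, fromBlocks_multiply]
  simp only [Matrix.zero_mul, Matrix.mul_zero, add_zero, zero_add, Matrix.mul_nonsing_inv _ hU, Matrix.one_mul, Matrix.smul_mul,
    Matrix.mul_smul, smul_smul, smul_zero]
  rw [inv_mul_cancel₀ hc, one_smul, fromBlocks_one, fromBlocks_one]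

/-- [folklore] … and a left inverse. -/
theorem inv_mul_shearT {U : Matrix ν ν ℝ} (hU : IsUnit U.det) {c : ℝ} (hc : c ≠ 0) :
    fromBlocks U⁻¹ 0 0 (fromBlocks (c⁻¹ • (1 : Matrix μ μ ℝ)) 0 0 (1 : Matrix ρ ρ ℝ))
        * fromBlocks U 0 0 (fromBlocks (c • (1 : Matrix μ μ ℝ)) 0 0 (1 : Matrix ρ ρ ℝ)) = 1 := by
  rw [fromBlocks_multiply, fromBlocks_multiply]
  simp only [Matrix.zero_mul, Matrix.mul_zero, add_zero, zero_add, Matrix.nonsing_inv_mul _ hU, Matrix.one_mul, Matrix.smul_mul,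
    Matrix.mul_smul, smul_smul, smul_zero]
  rw [mul_inv_cancel₀ hc, one_smul, fromBlocks_one, fromBlocks_one]

omit [Fintype μ] [Fintype ρ] in
/-- [folklore] The transpose of the inverse shear. -/
theorem transpose_shearT_inv (U : Matrix ν ν ℝ) (c : ℝ) :
    (fromBlocks U⁻¹ 0 0 (fromBlocks (c⁻¹ • (1 : Matrix μ μ ℝ)) 0 0 (1 : Matrix ρ ρ ℝ)))ᵀ
      = fromBlocks U⁻¹ᵀ 0 0 (fromBlocks (c⁻¹ • (1 : Matrix μ μ ℝ)) 0 0 (1 : Matrix ρ ρ ℝ)) := by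
  rw [fromBlocks_transpose, transpose_zero, transpose_zero, transpose_scaleBlock]

/-- [folklore] **THE INVERSE OF THE SHEARED BORDERED MATRIX**: `(kkt K [c•QU; τ])⁻¹ = T′ · (kkt K [Q; τ])⁻¹ · T′ᵀ` (`T′ = T⁻¹`; `det (kkt K [Q;τ]) ≠ 0`). -/
theorem inv_kkt_shear_slice {K U : Matrix ν ν ℝ} {τ : Matrix ρ ν ℝ} (hK : Uᵀ * K * U = K) (hτ : τ * U = τ) (hU : IsUnit U.det)
    {c : ℝ} (hc : c ≠ 0) (Q : Matrix μ ν ℝ) (hM : IsUnit (kkt K (fromRows Q τ)).det) :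
    (kkt K (fromRows (c • (Q * U)) τ))⁻¹
      = fromBlocks U⁻¹ 0 0 (fromBlocks (c⁻¹ • (1 : Matrix μ μ ℝ)) 0 0 (1 : Matrix ρ ρ ℝ)) * (kkt K (fromRows Q τ))⁻¹
          * (fromBlocks U⁻¹ 0 0 (fromBlocks (c⁻¹ • (1 : Matrix μ μ ℝ)) 0 0 (1 : Matrix ρ ρ ℝ)))ᵀ := by
  set T : Matrix (ν ⊕ (μ ⊕ ρ)) (ν ⊕ (μ ⊕ ρ)) ℝ := fromBlocks U 0 0 (fromBlocks (c • (1 : Matrix μ μ ℝ)) 0 0 (1 : Matrix ρ ρ ℝ)) with hT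
  set T' : Matrix (ν ⊕ (μ ⊕ ρ)) (ν ⊕ (μ ⊕ ρ)) ℝ := fromBlocks U⁻¹ 0 0 (fromBlocks (c⁻¹ • (1 : Matrix μ μ ℝ)) 0 0 (1 : Matrix ρ ρ ℝ)) with hT'
  have hTT' : T * T' = 1 := shearT_mul_inv hU hc
  have hT'T : T' * T = 1 := inv_mul_shearT hU hc
  have hTtT't : Tᵀ * T'ᵀ = 1 := by rw [← transpose_mul, hT'T, transpose_one]
  have hT'tTt : T'ᵀ * Tᵀ = 1 := by rw [← transpose_mul, hTT', transpose_one]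
  rw [kkt_shear_slice hK hτ Q c]
  refine Matrix.inv_eq_left_inv ?_
  -- `(T′ M⁻¹ T′ᵀ) · (Tᵀ M T) = 1`
  calc T' * (kkt K (fromRows Q τ))⁻¹ * T'ᵀ * (Tᵀ * kkt K (fromRows Q τ) * T)
      = T' * ((kkt K (fromRows Q τ))⁻¹ * ((T'ᵀ * Tᵀ) * kkt K (fromRows Q τ))) * T := by simp only [Matrix.mul_assoc]
    _ = 1 := by rw [hT'tTt, Matrix.one_mul, Matrix.nonsing_inv_mul _ hM, Matrix.mul_one, hT'T]

omit [DecidableEq ν] [DecidableEq μ] [DecidableEq ρ] in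
/-- [folklore] Block-diagonal outer factors commute with the restriction to the packed corner `ν ⊕ μ`:
`(diag(B₁,B₂,B₃) · X · diag(C₁,C₂,C₃))|_{ν⊕μ} = diag(B₁,B₂) · X|_{ν⊕μ} · diag(C₁,C₂)`. -/
theorem submatrix_blockDiag_mul_mul (B₁ C₁ : Matrix ν ν ℝ) (B₂ C₂ : Matrix μ μ ℝ) (B₃ C₃ : Matrix ρ ρ ℝ)
    (X : Matrix (ν ⊕ (μ ⊕ ρ)) (ν ⊕ (μ ⊕ ρ)) ℝ) :
    (fromBlocks B₁ 0 0 (fromBlocks B₂ 0 0 B₃) * X * fromBlocks C₁ 0 0 (fromBlocks C₂ 0 0 C₃)).submatrix (Sum.map id Sum.inl) (Sum.map id Sum.inl)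
      = fromBlocks B₁ 0 0 B₂ * X.submatrix (Sum.map id Sum.inl) (Sum.map id Sum.inl) * fromBlocks C₁ 0 0 C₂ := by
  ext i j
  simp only [Matrix.submatrix_apply, Matrix.mul_apply, Fintype.sum_sum_type]
  rcases i with i | i <;> rcases j with j | j <;>
    simp [fromBlocks, Matrix.of_apply, Sum.map, Finset.mul_sum, mul_comm, mul_left_comm]

/-- [folklore] **THE PACKED CORNER OF THE SHEARED INVERSE**: `(kkt K [c•QU; τ])⁻¹|_{ν⊕μ} = A · (kkt K [Q;τ])⁻¹|_{ν⊕μ} · Aᵀ`, `A = fromBlocks U⁻¹ 0 0 (c⁻¹•1)`. -/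
theorem inv_kkt_shear_submatrix {K U : Matrix ν ν ℝ} {τ : Matrix ρ ν ℝ} (hK : Uᵀ * K * U = K) (hτ : τ * U = τ) (hU : IsUnit U.det)
    {c : ℝ} (hc : c ≠ 0) (Q : Matrix μ ν ℝ) (hM : IsUnit (kkt K (fromRows Q τ)).det) :
    (kkt K (fromRows (c • (Q * U)) τ))⁻¹.submatrix (Sum.map id Sum.inl) (Sum.map id Sum.inl)
      = fromBlocks U⁻¹ 0 0 (c⁻¹ • (1 : Matrix μ μ ℝ)) * (kkt K (fromRows Q τ))⁻¹.submatrix (Sum.map id Sum.inl) (Sum.map id Sum.inl)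
          * (fromBlocks U⁻¹ 0 0 (c⁻¹ • (1 : Matrix μ μ ℝ)))ᵀ := by
  rw [inv_kkt_shear_slice hK hτ hU hc Q hM, transpose_shearT_inv, submatrix_blockDiag_mul_mul, fromBlocks_transpose, transpose_zero,
    transpose_zero, transpose_smul, transpose_one]

/-! ## §3 Two-sided transport of the one-loop functional -/

omit [DecidableEq ν] [Fintype μ] [Fintype ρ] [DecidableEq μ] [DecidableEq ρ] in
/-- [folklore] **`hessT` MOVES A CONGRUENCE FROM THE LEG TO THE JETS** (trace cyclicity; any square `A`, any index type):
`hessT (A·L·Aᵀ) V V′ W = hessT L (Aᵀ·V·A) (Aᵀ·V′·A) (Aᵀ·W·A)`. -/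
theorem hessT_conj {ι : Type*} [Fintype ι] (A L V V' W : Matrix ι ι ℝ) :
    hessT (A * L * Aᵀ) V V' W = hessT L (Aᵀ * V * A) (Aᵀ * V' * A) (Aᵀ * W * A) := by
  unfold hessT
  have t1 : (A * L * Aᵀ * W).trace = (L * (Aᵀ * W * A)).trace := by
    rw [show A * L * Aᵀ * W = A * (L * (Aᵀ * W)) by simp only [Matrix.mul_assoc], Matrix.trace_mul_comm]
    simp only [Matrix.mul_assoc]
  have t2 : (A * L * Aᵀ * V * (A * L * Aᵀ * V')).trace = (L * (Aᵀ * V * A) * (L * (Aᵀ * V' * A))).trace := by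
    rw [show A * L * Aᵀ * V * (A * L * Aᵀ * V') = A * (L * (Aᵀ * V * A) * (L * (Aᵀ * V'))) by simp only [Matrix.mul_assoc],
      Matrix.trace_mul_comm]
    simp only [Matrix.mul_assoc]
  rw [t1, t2]

/-- [folklore] **THE MODEL END OF «TB1-SYM»**: the torus one-loop functional of the SHEARED comb-gauged bordered inverse equals that of the OLD one read
against the SHEARED JETS `Aᵀ·J·A`, `A = fromBlocks U⁻¹ 0 0 (c⁻¹•1)` — TB1's packed-corner identity and TB5's limits apply verbatim to the sheared jets. -/
theorem hessT_inv_kkt_shear {K U : Matrix ν ν ℝ} {τ : Matrix ρ ν ℝ} (hK : Uᵀ * K * U = K) (hτ : τ * U = τ) (hU : IsUnit U.det)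
    {c : ℝ} (hc : c ≠ 0) (Q : Matrix μ ν ℝ) (hM : IsUnit (kkt K (fromRows Q τ)).det) (V V' W : Matrix (ν ⊕ μ) (ν ⊕ μ) ℝ) :
    hessT ((kkt K (fromRows (c • (Q * U)) τ))⁻¹.submatrix (Sum.map id Sum.inl) (Sum.map id Sum.inl)) V V' W
      = hessT ((kkt K (fromRows Q τ))⁻¹.submatrix (Sum.map id Sum.inl) (Sum.map id Sum.inl))
          ((fromBlocks U⁻¹ 0 0 (c⁻¹ • (1 : Matrix μ μ ℝ)))ᵀ * V * fromBlocks U⁻¹ 0 0 (c⁻¹ • (1 : Matrix μ μ ℝ)))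
          ((fromBlocks U⁻¹ 0 0 (c⁻¹ • (1 : Matrix μ μ ℝ)))ᵀ * V' * fromBlocks U⁻¹ 0 0 (c⁻¹ • (1 : Matrix μ μ ℝ)))
          ((fromBlocks U⁻¹ 0 0 (c⁻¹ • (1 : Matrix μ μ ℝ)))ᵀ * W * fromBlocks U⁻¹ 0 0 (c⁻¹ • (1 : Matrix μ μ ℝ))) := by
  rw [inv_kkt_shear_submatrix hK hτ hU hc Q hM, hessT_conj]

/-! ## §4 «3c-SYM»: the N-side (packed, massive) twin and the joint transport of TB5's difference

Appended 2026-08-21 by the same seat (road owner d1-p2-g7 ρ-g7-4 (iii)): the symmetrised MASSIVE matrix with the transported weight,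
`N^{sym} = kkt (K + UᵀBU) (c•QU) = Sᵀ · kkt (K + B) Q · S`, `S = fromBlocks U 0 0 (c•1)` on `ν ⊕ μ`, has inverse `A · (kkt (K + B) Q)⁻¹ · Aᵀ` with THE SAME
`A = fromBlocks U⁻¹ 0 0 (c⁻¹•1)` as the M-side, so the difference `hessT (M⁻¹|_{ν⊕μ}; J) − hessT (N⁻¹; J)` transports AS A WHOLE to the sheared jets `AᵀJA`. -/

omit [Fintype ρ] [DecidableEq ρ] [DecidableEq ν] in
/-- [folklore] **THE PACKED SHEAR CONGRUENCE, GENERAL FORM**: `Sᵀ · kkt K Q · S = kkt (UᵀKU) (c•QU)`, `S = fromBlocks U 0 0 (c•1)`. -/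
theorem kkt_shear_packed (K : Matrix ν ν ℝ) (Q : Matrix μ ν ℝ) (U : Matrix ν ν ℝ) (c : ℝ) :
    (fromBlocks U 0 0 (c • (1 : Matrix μ μ ℝ)))ᵀ * kkt K Q * fromBlocks U 0 0 (c • (1 : Matrix μ μ ℝ)) = kkt (Uᵀ * K * U) (c • (Q * U)) := by
  unfold kkt
  rw [fromBlocks_transpose, fromBlocks_multiply, fromBlocks_multiply]
  simp only [transpose_zero, transpose_smul, transpose_one, Matrix.zero_mul, Matrix.mul_zero, add_zero, zero_add, Matrix.smul_mul,
    Matrix.mul_smul, Matrix.one_mul, Matrix.mul_one, transpose_mul, smul_zero]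

omit [Fintype ρ] [DecidableEq ρ] [DecidableEq ν] in
/-- [folklore] **THE SYMMETRISED MASSIVE MATRIX WITH THE TRANSPORTED WEIGHT IS A CONGRUENCE**: `UᵀKU = K` ⟹
`kkt (K + UᵀBU) (c•QU) = Sᵀ · kkt (K + B) Q · S`. -/
theorem kkt_shear_packed_weight {K U : Matrix ν ν ℝ} (hK : Uᵀ * K * U = K) (B : Matrix ν ν ℝ) (Q : Matrix μ ν ℝ) (c : ℝ) :
    kkt (K + Uᵀ * B * U) (c • (Q * U))
      = (fromBlocks U 0 0 (c • (1 : Matrix μ μ ℝ)))ᵀ * kkt (K + B) Q * fromBlocks U 0 0 (c • (1 : Matrix μ μ ℝ)) := by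
  rw [kkt_shear_packed, Matrix.mul_add, Matrix.add_mul, hK]

omit [Fintype ρ] [DecidableEq ρ] in
/-- [folklore] `S · A = 1` (`IsUnit U.det`, `c ≠ 0`), `A = fromBlocks U⁻¹ 0 0 (c⁻¹•1)`. -/
theorem packS_mul_inv {U : Matrix ν ν ℝ} (hU : IsUnit U.det) {c : ℝ} (hc : c ≠ 0) :
    fromBlocks U 0 0 (c • (1 : Matrix μ μ ℝ)) * fromBlocks U⁻¹ 0 0 (c⁻¹ • (1 : Matrix μ μ ℝ)) = 1 := by
  rw [fromBlocks_multiply]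
  simp only [Matrix.zero_mul, Matrix.mul_zero, add_zero, zero_add, Matrix.mul_nonsing_inv _ hU, Matrix.smul_mul, Matrix.mul_smul,
    Matrix.one_mul, smul_smul, smul_zero]
  rw [inv_mul_cancel₀ hc, one_smul, fromBlocks_one]

omit [Fintype ρ] [DecidableEq ρ] in
/-- [folklore] `A · S = 1`. -/
theorem inv_mul_packS {U : Matrix ν ν ℝ} (hU : IsUnit U.det) {c : ℝ} (hc : c ≠ 0) :
    fromBlocks U⁻¹ 0 0 (c⁻¹ • (1 : Matrix μ μ ℝ)) * fromBlocks U 0 0 (c • (1 : Matrix μ μ ℝ)) = 1 := by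
  rw [fromBlocks_multiply]
  simp only [Matrix.zero_mul, Matrix.mul_zero, add_zero, zero_add, Matrix.nonsing_inv_mul _ hU, Matrix.smul_mul, Matrix.mul_smul,
    Matrix.one_mul, smul_smul, smul_zero]
  rw [mul_inv_cancel₀ hc, one_smul, fromBlocks_one]

omit [Fintype ρ] [DecidableEq ρ] in
/-- [folklore] **THE INVERSE OF THE SYMMETRISED MASSIVE MATRIX**: `(kkt (K + UᵀBU) (c•QU))⁻¹ = A · (kkt (K + B) Q)⁻¹ · Aᵀ` — the SAME `A` as the M-side. -/
theorem inv_kkt_shear_packed {K U : Matrix ν ν ℝ} (hK : Uᵀ * K * U = K) (hU : IsUnit U.det) {c : ℝ} (hc : c ≠ 0) (B : Matrix ν ν ℝ)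
    (Q : Matrix μ ν ℝ) (hN : IsUnit (kkt (K + B) Q).det) :
    (kkt (K + Uᵀ * B * U) (c • (Q * U)))⁻¹
      = fromBlocks U⁻¹ 0 0 (c⁻¹ • (1 : Matrix μ μ ℝ)) * (kkt (K + B) Q)⁻¹ * (fromBlocks U⁻¹ 0 0 (c⁻¹ • (1 : Matrix μ μ ℝ)))ᵀ := by
  set S : Matrix (ν ⊕ μ) (ν ⊕ μ) ℝ := fromBlocks U 0 0 (c • (1 : Matrix μ μ ℝ)) with hS
  set A : Matrix (ν ⊕ μ) (ν ⊕ μ) ℝ := fromBlocks U⁻¹ 0 0 (c⁻¹ • (1 : Matrix μ μ ℝ)) with hA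
  have hAS : A * S = 1 := inv_mul_packS hU hc
  have hSA : S * A = 1 := packS_mul_inv hU hc
  have hAtSt : Aᵀ * Sᵀ = 1 := by rw [← transpose_mul, hSA, transpose_one]
  rw [kkt_shear_packed_weight hK B Q c]
  refine Matrix.inv_eq_left_inv ?_
  calc A * (kkt (K + B) Q)⁻¹ * Aᵀ * (Sᵀ * kkt (K + B) Q * S)
      = A * ((kkt (K + B) Q)⁻¹ * ((Aᵀ * Sᵀ) * kkt (K + B) Q)) * S := by simp only [Matrix.mul_assoc]
    _ = 1 := by rw [hAtSt, Matrix.one_mul, Matrix.nonsing_inv_mul _ hN, Matrix.mul_one, hAS]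

omit [Fintype ρ] [DecidableEq ρ] in
/-- [folklore] **THE N-SIDE TRANSPORT**: `hessT ((kkt (K + UᵀBU) (c•QU))⁻¹; J) = hessT ((kkt (K + B) Q)⁻¹; AᵀJA)`. -/
theorem hessT_inv_kkt_shear_packed {K U : Matrix ν ν ℝ} (hK : Uᵀ * K * U = K) (hU : IsUnit U.det) {c : ℝ} (hc : c ≠ 0) (B : Matrix ν ν ℝ)
    (Q : Matrix μ ν ℝ) (hN : IsUnit (kkt (K + B) Q).det) (V V' W : Matrix (ν ⊕ μ) (ν ⊕ μ) ℝ) :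
    hessT ((kkt (K + Uᵀ * B * U) (c • (Q * U)))⁻¹) V V' W
      = hessT ((kkt (K + B) Q)⁻¹)
          ((fromBlocks U⁻¹ 0 0 (c⁻¹ • (1 : Matrix μ μ ℝ)))ᵀ * V * fromBlocks U⁻¹ 0 0 (c⁻¹ • (1 : Matrix μ μ ℝ)))
          ((fromBlocks U⁻¹ 0 0 (c⁻¹ • (1 : Matrix μ μ ℝ)))ᵀ * V' * fromBlocks U⁻¹ 0 0 (c⁻¹ • (1 : Matrix μ μ ℝ)))
          ((fromBlocks U⁻¹ 0 0 (c⁻¹ • (1 : Matrix μ μ ℝ)))ᵀ * W * fromBlocks U⁻¹ 0 0 (c⁻¹ • (1 : Matrix μ μ ℝ))) := by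
  rw [inv_kkt_shear_packed hK hU hc B Q hN, hessT_conj]

/-- [folklore] **THE JOINT END OF «TB1-SYM» + «3c-SYM»**: TB5's M-minus-N difference transports AS A WHOLE to the SAME sheared jets `AᵀJA`. -/
theorem hessT_sub_shear {K U : Matrix ν ν ℝ} {τ : Matrix ρ ν ℝ} (hK : Uᵀ * K * U = K) (hτ : τ * U = τ) (hU : IsUnit U.det)
    {c : ℝ} (hc : c ≠ 0) (B : Matrix ν ν ℝ) (Q : Matrix μ ν ℝ) (hM : IsUnit (kkt K (fromRows Q τ)).det) (hN : IsUnit (kkt (K + B) Q).det)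
    (V V' W : Matrix (ν ⊕ μ) (ν ⊕ μ) ℝ) :
    hessT ((kkt K (fromRows (c • (Q * U)) τ))⁻¹.submatrix (Sum.map id Sum.inl) (Sum.map id Sum.inl)) V V' W
        - hessT ((kkt (K + Uᵀ * B * U) (c • (Q * U)))⁻¹) V V' W
      = hessT ((kkt K (fromRows Q τ))⁻¹.submatrix (Sum.map id Sum.inl) (Sum.map id Sum.inl))
          ((fromBlocks U⁻¹ 0 0 (c⁻¹ • (1 : Matrix μ μ ℝ)))ᵀ * V * fromBlocks U⁻¹ 0 0 (c⁻¹ • (1 : Matrix μ μ ℝ)))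
          ((fromBlocks U⁻¹ 0 0 (c⁻¹ • (1 : Matrix μ μ ℝ)))ᵀ * V' * fromBlocks U⁻¹ 0 0 (c⁻¹ • (1 : Matrix μ μ ℝ)))
          ((fromBlocks U⁻¹ 0 0 (c⁻¹ • (1 : Matrix μ μ ℝ)))ᵀ * W * fromBlocks U⁻¹ 0 0 (c⁻¹ • (1 : Matrix μ μ ℝ)))
        - hessT ((kkt (K + B) Q)⁻¹)
          ((fromBlocks U⁻¹ 0 0 (c⁻¹ • (1 : Matrix μ μ ℝ)))ᵀ * V * fromBlocks U⁻¹ 0 0 (c⁻¹ • (1 : Matrix μ μ ℝ)))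
          ((fromBlocks U⁻¹ 0 0 (c⁻¹ • (1 : Matrix μ μ ℝ)))ᵀ * V' * fromBlocks U⁻¹ 0 0 (c⁻¹ • (1 : Matrix μ μ ℝ)))
          ((fromBlocks U⁻¹ 0 0 (c⁻¹ • (1 : Matrix μ μ ℝ)))ᵀ * W * fromBlocks U⁻¹ 0 0 (c⁻¹ • (1 : Matrix μ μ ℝ))) := by
  rw [hessT_inv_kkt_shear hK hτ hU hc Q hM, hessT_inv_kkt_shear_packed hK hU hc B Q hN]

end Summit.QuantumFields.BalabanUV.Beta.D1BFx.ShearedBorderKKT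

end
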